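import Summits.ABC.IUTFork.Cor312LicenceTameExactAllPlaces
import Summits.ABC.IUTFork.Cor312LicenceShallowMultiSlotMinRam
import HarnessLib

/-!
# [IUTchIII] Cor. 3.12, branch C — for REALISING pilot ideles with INTEGRAL q-degrees over uniformly tame bad fibres the per-datum
# hull licence (and the S_H antecedent) is ONE explicit integer predicate: `∀ bad w | p, ∀ j ≤ l⋆: e_p·((j²·P_w − 1) div e_p) + 1 − j·(e_p − 1) ≤ P_w`

PROOF-ONLY record file (no `def`, no new `Prop`, no instance) of the abc-iut cell (WAVE-5 prover seat abc-iut-w5-d009, gen 10; row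
«GENUINE-WINDOW-EXACT», part 1 of 2 — the generic realising-idele form; part 2 `Cor312LicenceTameExactGenuineK.lean` reads it at the
GENUINE `K`-level datum `Cor312Prov.pilotDataOfK D K`). TAKES NO SIDE on [IUTchIII] Cor. 3.12 or on any author. Sequel of this lineage's
`Cor312LicenceShallowMultiSlotGenuineK.lean` / `…GenuineKInhabited.lean` (p443270 ✓ / p445626 ✓: at genuine data the licence is REFUTED unless
`(l⋆−1)·P_w ≤ e_w − 1` and INHABITED once `m_p·(l⋆²−1)·P_w ≤ l⋆·e_w·(m_p−1)` — an undecided strip in between) and of abc-iut-w4-d006's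
`Cor312LicenceTameExactAllPlaces.lean` (p445547 ✓: for INTEGER exponents `‖t_{Θ,j,w}‖ = ‖ϖ_w‖^{m_Θ}`, `‖t_{q,w}‖ = ‖ϖ_w‖^{m_q}` over uniformly
tame fibres the licence is decided EXACTLY: `Licence ↔ ∀ bad w ∀ j: e·((m_Θ−1) div e) + 1 − j(e−1) ≤ m_q`).

THE POINT. For ideles REALISING the pilot divisors (Dupuy–Hilado (3.4): `‖t_{Θ,j,w}‖ = p^{−j²P_q(w)/e_w}`, `‖t_{q,w}‖ = p^{−P_q(w)/e_w}`,
abc-iut-w5-d236 `norm_thetaIdele_eq_rpow_of_realises` / `norm_qIdele_eq_rpow_of_realises`) with INTEGRAL q-degrees `P_q(w) = P_w ∈ ℤ_{≥1}`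
the exponents ARE integers (`m_Θ = j²·P_w`, `m_q = P_w`; uniformizers of `F_w` with `‖ϖ_w‖ = p^{−1/e(w|p)}` from abc-iut-S7's
`exists_isUniformizer_rescaledCompletion`), so p445547 applies verbatim and the undecided strip of gen 9 is CLOSED for such ideles: the
per-datum licence — and with it branch C's per-datum S_H antecedent «∃ ρ qK, QPinned ∧ PilotKummerCompatHull» (the label `0` is free for
q-ideles of norm `≤ 1`) — holds IFF the displayed integer predicate holds. (At the genuine datum the q-degrees are integral for free,
[IUTchI] Ex. 3.2 (iv) — part 2.)

WHAT IS PROVED (namespace `Summit.ABC.IUTFork.Thm311.Real`).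
* §1 (integers only): `tame_exact_iff_emod` (the predicate at `(e, P, j)` ⟺ `(j²−1)·P − j·(e−1) ≤ (j²P − 1) mod e`);
  `tame_exact_of_sufficient_leg` (gen 9's sufficient leg `(L²−1)·P ≤ L·(e−1)` ⟹ the predicate at every `j ≤ L`);
  `necessary_leg_of_tame_exact` (the predicate at `j = L` ⟹ gen 9's necessary leg `(L−1)·P ≤ e−1`); two `example`s: the strip was NOT
  empty and the exact predicate decides it BOTH ways — `(e, P, L) = (10, 1, 10)` satisfies the predicate at every `j ≤ 10` but not the
  sufficient leg; `(e, P, L) = (19, 2, 10)` satisfies the necessary leg but violates the predicate at `j = 10`.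
* §2 (generic Dupuy–Hilado datum `X`, REALISING ideles, INTEGRAL q-degrees at the bad places, uniformly tame bad fibres):
  **`licence_settingDHVolSharp_iff_of_realises_tame`**, **`licence_settingPrVolSharp_iff_of_realises_tame`**;
  `exists_qPinned_and_hull_settingPrVolSharp_iff_licence` (for ANY q-ideles of norm `≤ 1`: branch C's antecedent ⟺ the licence, any columns);
  **`exists_qPinned_and_hull_settingPrVolSharp_iff_of_realises_tame`**.

READING (numbers, not adjectives; nothing about print): in OUR sharp containers, with Dupuy–Hilado's typed (Ind2) acting independently on
every (capsule slot, place), the per-datum S_H / (xi-f)-licence question for realising ideles with integral q-degrees over uniformly tame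
bad fibres is a DECIDABLE arithmetic predicate of `(e(w|p), P_w, j)` over the bad places — no strip is left between «refuted» and
«inhabited». The uniform tameness hypothesis (every place of `F` over a bad prime `p` has the same `e(x|p) = e_p ≤ p − 2`, `p > 2`) is that
of p445547. HONEST SCOPE: OUR containers; the hull-level licence is a STRONGER-THAN-PRINT form of Step (xi-f) (referee lanes A1/A2);
nothing about the printed GLOBAL inequality or the NUMBER-level corollary; refuted-as-typed ≠ refuted-in-print; nothing asserts or refutes
[IUTchIII] Cor. 3.12; typed ≠ proved; instantiated ≠ endorsed.
[cite: Mochizuki2012, IUTchIII Cor. 3.12 p. 173–175, Step (xi) (xi-f) p. 184, Thm. 3.11 (i) (Ind2) p. 154; IUTchIV Prop. 1.1 p. 9, Prop. 1.2 (i)(ii) p. 10]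
[cite: DupuyHilado2025, §3.3, §3.4, §3.9, §4.9] [cite: NeukirchANT1999, Ch. II Prop. (5.5), (6.8)] [claim: Mochizuki2012, status: disputed]
for every IUT sentence quoted.
-/

noncomputable section

open Set Function NumberField IsDedekindDomain
open scoped Pointwise

/-! ## §1. Integer bookkeeping: the exact predicate and gen 9's two legs -/

namespace Summit.ABC.IUTFork.Thm311.Real

/-- **The exact tame predicate in closed form.** For `e > 0`: `e·((j²P − 1) div e) + 1 − j(e−1) ≤ P` iff
`(j² − 1)·P − j·(e − 1) ≤ (j²P − 1) mod e` (because `e·(x div e) = x − x mod e`). [folklore] -/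
theorem tame_exact_iff_emod {e : ℤ} (he : 0 < e) (j P : ℤ) :
    e * ((j ^ 2 * P - 1) / e) + 1 - j * (e - 1) ≤ P ↔ (j ^ 2 - 1) * P - j * (e - 1) ≤ (j ^ 2 * P - 1) % e := by
  have h := Int.mul_ediv_add_emod (j ^ 2 * P - 1) e
  have he0 : e ≠ 0 := he.ne'
  constructor <;> intro h1 <;> linarith [h, he0]

/-- **Gen 9's SUFFICIENT leg implies the exact predicate at every label**: for `e ≥ 1`, `P ≥ 0`, `1 ≤ j ≤ L` and
`(L² − 1)·P ≤ L·(e − 1)` one has `e·((j²P − 1) div e) + 1 − j(e−1) ≤ P` (`e·(x div e) ≤ x` and `(j²−1)/j ≤ (L²−1)/L`).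
[folklore] -/
theorem tame_exact_of_sufficient_leg {e j L P : ℤ} (he : 1 ≤ e) (hP : 0 ≤ P) (hj : 1 ≤ j) (hjL : j ≤ L)
    (hsuff : (L ^ 2 - 1) * P ≤ L * (e - 1)) :
    e * ((j ^ 2 * P - 1) / e) + 1 - j * (e - 1) ≤ P := by
  have he0 : e ≠ 0 := by omega
  have hdiv : e * ((j ^ 2 * P - 1) / e) ≤ j ^ 2 * P - 1 := Int.mul_ediv_self_le he0
  -- `(j² − 1)·L ≤ j·(L² − 1)` since `(j − L)(jL + 1) ≤ 0`
  have hmono : (j ^ 2 - 1) * L ≤ j * (L ^ 2 - 1) := by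
    have h0 : 0 ≤ (L - j) * (j * L) := mul_nonneg (by omega) (mul_nonneg (by omega) (by omega))
    nlinarith [h0]
  -- multiply the sufficient leg by `j`, compare with `(j²−1)·P·L`, divide by `L ≥ 1`
  have hL : 1 ≤ L := le_trans hj hjL
  have h1 : (j ^ 2 - 1) * P * L ≤ j * (e - 1) * L := by
    calc (j ^ 2 - 1) * P * L = ((j ^ 2 - 1) * L) * P := by ring
      _ ≤ (j * (L ^ 2 - 1)) * P := mul_le_mul_of_nonneg_right hmono hP
      _ = j * ((L ^ 2 - 1) * P) := by ring
      _ ≤ j * (L * (e - 1)) := mul_le_mul_of_nonneg_left hsuff (by omega)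
      _ = j * (e - 1) * L := by ring
  have h2 : (j ^ 2 - 1) * P ≤ j * (e - 1) := le_of_mul_le_mul_right h1 (by omega)
  linarith

/-- **The exact predicate at the top label implies gen 9's NECESSARY leg**: for `e ≥ 1`, `L ≥ 1`, from
`e·((L²P − 1) div e) + 1 − L(e−1) ≤ P` follows `(L − 1)·P ≤ e − 1` (`e·(x div e) ≥ x − (e − 1)`, then divide by `L + 1`). [folklore] -/
theorem necessary_leg_of_tame_exact {e L P : ℤ} (he : 1 ≤ e) (hL : 1 ≤ L)
    (hex : e * ((L ^ 2 * P - 1) / e) + 1 - L * (e - 1) ≤ P) : (L - 1) * P ≤ e - 1 := by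
  have h := Int.mul_ediv_add_emod (L ^ 2 * P - 1) e
  have hmod : (L ^ 2 * P - 1) % e < e := Int.emod_lt_of_pos _ (by omega)
  have h1 : (L + 1) * ((L - 1) * P) ≤ (L + 1) * (e - 1) := by nlinarith
  exact le_of_mul_le_mul_left h1 (by omega)

/-- **The strip between the two legs was NOT empty, and the exact predicate decides it — inhabited side**: at `(e, P, L) = (10, 1, 10)`
the predicate holds at every label `j ≤ 10` although the sufficient leg `(L²−1)·P ≤ L·(e−1)` (`99 ≤ 90`) fails. [folklore] -/
example : (∀ j : ℕ, 1 ≤ j → j ≤ 10 → (10 : ℤ) * ((((j : ℤ) ^ 2 * 1 - 1)) / 10) + 1 - (j : ℤ) * (10 - 1) ≤ 1) ∧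
    ¬ (((10 : ℤ) ^ 2 - 1) * 1 ≤ 10 * (10 - 1)) := by
  refine ⟨fun j hj1 hj2 => ?_, by norm_num⟩
  interval_cases j <;> norm_num

/-- **… refuted side**: at `(e, P, L) = (19, 2, 10)` the necessary leg `(L−1)·P ≤ e−1` (`18 ≤ 18`) holds although the predicate FAILS at
the label `j = 10` (`19·⌊199/19⌋ + 1 − 10·18 = 11 > 2`). [folklore] -/
example : ((10 : ℤ) - 1) * 2 ≤ 19 - 1 ∧ ¬ ((19 : ℤ) * (((10 : ℤ) ^ 2 * 2 - 1) / 19) + 1 - 10 * (19 - 1) ≤ 2) := by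
  constructor <;> norm_num

/-! ## §2. Generic datum, REALISING ideles with INTEGRAL q-degrees: the licence is the exact predicate -/

open Cor312 Cor312.Setting Cor312Vol Cor312Vol.ExplicitDepth Literature.IUT.LogThetaLattice Literature.IUT.LogVolume
open Literature.NumberTheory.NumberFields Literature.NumberTheory.GaloisRepresentations.Ultrametric

variable {F : Type} [Field F] [NumberField F] (X : PilotData F) {logv : PadicLogs F} (hlog : LogvAnalytic logv)
  (M : Type) [Field M] [NumberField M]
  (archPk : ∀ (j : (thetaIndex X).Label) (vQ : (thetaIndex X).VQ), Set ((logShellsDH X logv).Packet j vQ))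
  (archSub : ∀ (j : (thetaIndex X).Label) (v : (thetaIndex X).V),
    Set ((logShellsDH X logv).Packet j ((thetaIndex X).over v)))
  (Ψ : ℤ → ∀ v : (thetaIndex X).V, v ∈ (thetaIndex X).Vbad → Set ((logShellsDH X logv).StarPacket v))
  (act : ℤ → ∀ v : (thetaIndex X).V, v ∈ (thetaIndex X).Vbad →
    (logShellsDH X logv).StarPacket v → Module.End ℚ ((logShellsDH X logv).StarPacket v))
  (Mmod : ℤ → ∀ j : (thetaIndex X).LabelStar, Set ((logShellsDH X logv).GlobalPacket j.1))
  (region : ℤ → ∀ j : (thetaIndex X).LabelStar, FinDivisor M → ∀ vQ : (thetaIndex X).VQ,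
    Set ((logShellsDH X logv).Packet j.1 vQ))
  (n : ℤ) {HT : Type} {LogLink : HT → HT → Type} {IsFull : ∀ {s t : HT}, LogLink s t → Prop}
  (lat : LGPGaussianLogThetaLattice LogLink IsFull)
  {Frd : Type} {IsoF : Frd → Frd → Type} {Ob : Frd → Type} {realify : Frd → Frd} {Strip : Type}
  {IsoS : Strip → Strip → Type} {Mv : ∀ v : (thetaIndex X).V, v ∈ (thetaIndex X).Vbad → Type}
  [∀ v h, Monoid (Mv v h)]
  (sig : GlobalLGPFrobenioidSignature (thetaIndex X).lstar (thetaIndex X).V (· ∈ (thetaIndex X).Vbad)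
    Frd IsoF Ob realify Strip IsoS Mv)
  (split : SplittingMonoids Mv) {ObΔ : Type} {N : ∀ v : (thetaIndex X).V, v ∈ (thetaIndex X).Vbad → Type}
  [∀ v h, Monoid (N v h)] (qData : QPilotData ObΔ N)
  (tq : ∀ (pp : Nat.Primes) (x : (thetaIndex X).Fibre (.inr pp)), haveI : Fact (pp : ℕ).Prime := ⟨pp.2⟩; kOf X pp.1 x)
  (t : ∀ (pp : Nat.Primes) (_ : Fin X.lstar) (x : (thetaIndex X).Fibre (.inr pp)),
    haveI : Fact (pp : ℕ).Prime := ⟨pp.2⟩; kOf X pp.1 x)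
  (htq0 : ∀ pp x, tq pp x ≠ 0)
  (htq1 : ∀ (pp : Nat.Primes) (x : (thetaIndex X).Fibre (.inr pp)),
    haveI : Fact (pp : ℕ).Prime := ⟨pp.2⟩; placeOf X pp.1 x ∉ X.S → ‖tq pp x‖ = 1)
  (col : ℤ → Column (logShellsDH X logv))
  (ht0 : ∀ pp i x, t pp i x ≠ 0)
  (ht : ∀ (pp : Nat.Primes) (i : Fin X.lstar) (x : (thetaIndex X).Fibre (.inr pp)),
    haveI : Fact (pp : ℕ).Prime := ⟨pp.2⟩
    Real.log ‖t pp i x‖ = -(X.thetaPilot i (placeOf X pp.1 x)) * logNorm F (placeOf X pp.1 x) /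
      localDegree F (placeOf X pp.1 x))
  (htq : ∀ (pp : Nat.Primes) (x : (thetaIndex X).Fibre (.inr pp)),
    haveI : Fact (pp : ℕ).Prime := ⟨pp.2⟩
    Real.log ‖tq pp x‖ = -(X.qPilot (placeOf X pp.1 x)) * logNorm F (placeOf X pp.1 x) /
      localDegree F (placeOf X pp.1 x))

include ht0 ht htq in
/-- **THE (xi-f) LICENCE AT `settingDHVolSharp` FOR REALISING IDELES WITH INTEGRAL q-DEGREES IS THE EXACT TAME PREDICATE.** Θ- and
q-ideles realising the pilot divisors of `X`; at every BAD place `w` (i.e. `w ∈ S`) the q-degree is an integer `P_q(w) = P_w ∈ ℤ_{≥1}`;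
every place `x` of `F` over a prime `p` below a bad place is tame with the SAME index `e(x|p) = e_p ≤ p − 2` (`p > 2`). THEN
abc-iut-c312-1's `Thm311ToCor312.Licence` at abc-iut-c312-3's `settingDHVolSharp X …` holds **iff** at every bad `w | p` and every label
`j = i+1 ∈ 𝔽_l^⋇`: `e_p·((j²·P_w − 1) div e_p) + 1 − j·(e_p − 1) ≤ P_w`. (abc-iut-w4-d006's `licence_settingDHVolSharp_iff_of_tame_orders`
with `m_Θ = j²·P_w`, `m_q = P_w` read off `norm_thetaIdele_eq_rpow_of_realises` / `norm_qIdele_eq_rpow_of_realises`, uniformizers from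
`exists_isUniformizer_rescaledCompletion`.) [cite: DupuyHilado2025, §3.3, §3.4, §4.9] [cite: NeukirchANT1999, Ch. II Prop. (5.5), (6.8)]
[claim: Mochizuki2012, status: disputed] -/
theorem licence_settingDHVolSharp_iff_of_realises_tame (e : Nat.Primes → ℕ)
    (hfib : ∀ (pp : Nat.Primes) (x : (thetaIndex X).Fibre (.inr pp)),
      haveI : Fact (pp : ℕ).Prime := ⟨pp.2⟩
      (∃ w : (thetaIndex X).Fibre (.inr pp), placeOf X pp.1 w ∈ X.S) →
        2 < (pp : ℕ) ∧ e pp ≤ (pp : ℕ) - 2 ∧ (placeOf X pp.1 x).asIdeal.ramificationIdx ℤ = e pp)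
    (P : ∀ pp : Nat.Primes, (thetaIndex X).Fibre (.inr pp) → ℕ)
    (hP : ∀ (pp : Nat.Primes) (w : (thetaIndex X).Fibre (.inr pp)),
      haveI : Fact (pp : ℕ).Prime := ⟨pp.2⟩; placeOf X pp.1 w ∈ X.S → X.qPilot (placeOf X pp.1 w) = P pp w)
    (hP1 : ∀ (pp : Nat.Primes) (w : (thetaIndex X).Fibre (.inr pp)),
      haveI : Fact (pp : ℕ).Prime := ⟨pp.2⟩; placeOf X pp.1 w ∈ X.S → 1 ≤ P pp w) :
    Thm311ToCor312.Licence (settingDHVolSharp X hlog M archPk archSub Ψ act Mmod region n lat sig split qData tq t htq0 htq1) ↔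
      ∀ (pp : Nat.Primes) (i : Fin (thetaIndex X).lstar) (w : (thetaIndex X).Fibre (.inr pp)),
        haveI : Fact (pp : ℕ).Prime := ⟨pp.2⟩; placeOf X pp.1 w ∈ X.S →
          (e pp : ℤ) * (((((i : ℕ) + 1 : ℕ) : ℤ) ^ 2 * (P pp w : ℤ) - 1) / e pp) + 1 -
            ((i : ℕ) + 1 : ℕ) * ((e pp : ℤ) - 1) ≤ (P pp w : ℤ) := by
  -- uniformizers of the rescaled completions, `‖ϖ_x‖ = p^{−1/e(x|p)}`
  have hex : ∀ (pp : Nat.Primes) (x : (thetaIndex X).Fibre (.inr pp)),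
      haveI : Fact (pp : ℕ).Prime := ⟨pp.2⟩
      ∃ ϖ : (kOf X pp.1 x)ˣ, IsUniformizer ϖ ∧ ‖(ϖ : kOf X pp.1 x)‖ =
        ((pp : ℕ) : ℝ) ^ (-(1 / ((placeOf X pp.1 x).asIdeal.ramificationIdx ℤ : ℝ))) := fun pp x => by
    haveI : Fact (pp : ℕ).Prime := ⟨pp.2⟩
    exact exists_isUniformizer_rescaledCompletion F pp.1 (placeOf X pp.1 x) (natCast_mem_placeOf X pp.1 x)
  choose ϖ hϖ using hex
  -- the norm identities at a bad place `w | p`: `‖t_{Θ,i,w}‖ = ‖ϖ_w‖^{(i+1)²P_w}`, `‖t_{q,w}‖ = ‖ϖ_w‖^{P_w}`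
  have key : ∀ (pp : Nat.Primes) (w : (thetaIndex X).Fibre (.inr pp)),
      haveI : Fact (pp : ℕ).Prime := ⟨pp.2⟩
      placeOf X pp.1 w ∈ X.S → ∀ m : ℤ, ∀ c : ℝ, (c : ℝ) = (m : ℝ) →
        ((pp : ℕ) : ℝ) ^ (-(c * X.qPilot (placeOf X pp.1 w)) / (ramIdx F (placeOf X pp.1 w) : ℝ)) =
          ‖(ϖ pp w : kOf X pp.1 w)‖ ^ (m * (P pp w : ℤ)) := by
    intro pp w hw m c hc
    haveI : Fact (pp : ℕ).Prime := ⟨pp.2⟩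
    obtain ⟨-, -, hram⟩ := hfib pp w ⟨w, hw⟩
    have hp0 : (0 : ℝ) < ((pp : ℕ) : ℝ) := by exact_mod_cast pp.2.pos
    have hramF : (ramIdx F (placeOf X pp.1 w) : ℝ) = (e pp : ℝ) := by
      rw [ramIdx_eq F (placeOf X pp.1 w), hram]
    have hϖn : ‖(ϖ pp w : kOf X pp.1 w)‖ = ((pp : ℕ) : ℝ) ^ (-(1 / (e pp : ℝ))) := by
      rw [(hϖ pp w).2, hram]
    rw [hϖn, ← Real.rpow_intCast, ← Real.rpow_mul hp0.le, hP pp w hw, hramF, hc]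
    congr 1
    push_cast
    ring
  refine licence_settingDHVolSharp_iff_of_tame_orders X hlog M archPk archSub Ψ act Mmod region n lat sig split qData tq t htq0 htq1
    (fun pp i x hx => norm_eq_one_of_realises X t ht0 ht pp i x hx) e ϖ (fun pp x hS => ?_)
    (fun pp i w => ((((i : ℕ) + 1 : ℕ) : ℤ) ^ 2 * (P pp w : ℤ))) (fun pp w => (P pp w : ℤ))
    (fun pp i w hw => ?_) (fun pp w hw => ?_) (fun pp i w hw => ?_)
  · -- the tame fibre with its uniformizers
    haveI : Fact (pp : ℕ).Prime := ⟨pp.2⟩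
    obtain ⟨hp2, hep, hram⟩ := hfib pp x hS
    exact ⟨hp2, hep, hram, (hϖ pp x).1⟩
  · -- `‖t_{Θ,i,w}‖ = ‖ϖ_w‖^{(i+1)²·P_w}`
    haveI : Fact (pp : ℕ).Prime := ⟨pp.2⟩
    rw [norm_thetaIdele_eq_rpow_of_realises X tq t htq0 ht0 ht htq pp i w]
    exact key pp w hw _ _ (by push_cast; ring)
  · -- `‖t_{q,w}‖ = ‖ϖ_w‖^{P_w}`
    haveI : Fact (pp : ℕ).Prime := ⟨pp.2⟩
    rw [norm_qIdele_eq_rpow_of_realises X tq htq0 htq pp w]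
    have h := key pp w hw 1 1 (by norm_num)
    rw [one_mul, one_mul] at h
    exact h
  · -- `1 ≤ (i+1)²·P_w`
    haveI : Fact (pp : ℕ).Prime := ⟨pp.2⟩
    have h1 : (1 : ℤ) ≤ (P pp w : ℤ) := by exact_mod_cast hP1 pp w hw
    have h2 : (1 : ℤ) ≤ (((i : ℕ) + 1 : ℕ) : ℤ) ^ 2 := one_le_pow₀ (by exact_mod_cast Nat.succ_le_succ (Nat.zero_le _))
    nlinarith

include ht0 ht htq in
/-- **The same at the print-normalised setting `settingPrVolSharp`** (abc-iut-c312-7; `licence_settingPrVolSharp_iff_settingDHVolSharp`).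
[cite: DupuyHilado2025, §3.4, §4.9] [claim: Mochizuki2012, status: disputed] -/
theorem licence_settingPrVolSharp_iff_of_realises_tame (e : Nat.Primes → ℕ)
    (hfib : ∀ (pp : Nat.Primes) (x : (thetaIndex X).Fibre (.inr pp)),
      haveI : Fact (pp : ℕ).Prime := ⟨pp.2⟩
      (∃ w : (thetaIndex X).Fibre (.inr pp), placeOf X pp.1 w ∈ X.S) →
        2 < (pp : ℕ) ∧ e pp ≤ (pp : ℕ) - 2 ∧ (placeOf X pp.1 x).asIdeal.ramificationIdx ℤ = e pp)
    (P : ∀ pp : Nat.Primes, (thetaIndex X).Fibre (.inr pp) → ℕ)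
    (hP : ∀ (pp : Nat.Primes) (w : (thetaIndex X).Fibre (.inr pp)),
      haveI : Fact (pp : ℕ).Prime := ⟨pp.2⟩; placeOf X pp.1 w ∈ X.S → X.qPilot (placeOf X pp.1 w) = P pp w)
    (hP1 : ∀ (pp : Nat.Primes) (w : (thetaIndex X).Fibre (.inr pp)),
      haveI : Fact (pp : ℕ).Prime := ⟨pp.2⟩; placeOf X pp.1 w ∈ X.S → 1 ≤ P pp w) :
    Thm311ToCor312.Licence (settingPrVolSharp X hlog M archPk archSub Ψ act Mmod region n lat sig split qData tq t htq0 htq1) ↔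
      ∀ (pp : Nat.Primes) (i : Fin (thetaIndex X).lstar) (w : (thetaIndex X).Fibre (.inr pp)),
        haveI : Fact (pp : ℕ).Prime := ⟨pp.2⟩; placeOf X pp.1 w ∈ X.S →
          (e pp : ℤ) * (((((i : ℕ) + 1 : ℕ) : ℤ) ^ 2 * (P pp w : ℤ) - 1) / e pp) + 1 -
            ((i : ℕ) + 1 : ℕ) * ((e pp : ℤ) - 1) ≤ (P pp w : ℤ) := by
  rw [licence_settingPrVolSharp_iff_settingDHVolSharp]
  exact licence_settingDHVolSharp_iff_of_realises_tame X hlog M archPk archSub Ψ act Mmod region n lat sig split qData tq t htq0 htq1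
    ht0 ht htq e hfib P hP hP1

/-- **For q-ideles of norm `≤ 1` branch C's per-datum antecedent «∃ ρ qK, QPinned ∧ PilotKummerCompatHull» at `settingPrVolSharp` IS the
(xi-f) licence** (any columns `col`; abc-iut-C-cert-1's `Conditional.Antecedent.exists_qPinned_and_hull_iff`: the bundle is the hull inclusion
at EVERY label `j ∈ {0, …, l⋆}`; at the label `0` the Θ-idele is `1`, so the identity is a mover there — `exists_mover_of_norm_le`). [folklore]
[claim: Mochizuki2012, status: disputed] -/
theorem exists_qPinned_and_hull_settingPrVolSharp_iff_licence (htqle : ∀ pp x, ‖tq pp x‖ ≤ 1) :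
    (∃ (ρ : (∀ v : (thetaIndex X).V, v ∈ (thetaIndex X).Vbad → Set ((logShellsDH X logv).StarPacket v)) →
          ∀ (j : (thetaIndex X).Label) (vQ : (thetaIndex X).VQ), Set ((logShellsDH X logv).Packet j vQ))
        (qK : ∀ v : (thetaIndex X).V, v ∈ (thetaIndex X).Vbad → Set ((logShellsDH X logv).StarPacket v)),
        QPinned ({ toSituation := situationPrVol X hlog M archPk archSub Ψ act Mmod region, col := col } :
            LatticeSituation (thetaIndex X))
          (settingPrVolSharp X hlog M archPk archSub Ψ act Mmod region n lat sig split qData tq t htq0 htq1) ρ qK ∧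
        PilotKummerCompatHull ({ toSituation := situationPrVol X hlog M archPk archSub Ψ act Mmod region, col := col } :
            LatticeSituation (thetaIndex X))
          (settingPrVolSharp X hlog M archPk archSub Ψ act Mmod region n lat sig split qData tq t htq0 htq1) ρ qK) ↔
      Thm311ToCor312.Licence (settingPrVolSharp X hlog M archPk archSub Ψ act Mmod region n lat sig split qData tq t htq0 htq1) := by
  constructor
  · rintro ⟨ρ, qK, hq, hh⟩
    exact licence_of_pilotKummerCompatHull
      ({ toSituation := situationPrVol X hlog M archPk archSub Ψ act Mmod region, col := col } : LatticeSituation (thetaIndex X))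
      (settingPrVolSharp X hlog M archPk archSub Ψ act Mmod region n lat sig split qData tq t htq0 htq1) ρ qK hq hh
  · intro hL
    refine (Conditional.Antecedent.exists_qPinned_and_hull_iff
      ({ toSituation := situationPrVol X hlog M archPk archSub Ψ act Mmod region, col := col } : LatticeSituation (thetaIndex X))
      (settingPrVolSharp X hlog M archPk archSub Ψ act Mmod region n lat sig split qData tq t htq0 htq1)).2 fun j vQ => ?_
    rcases Fin.eq_zero_or_eq_succ j with rfl | ⟨i, rfl⟩
    · -- the label `0`: the Θ-idele is `1`, the identity moves
      refine qRegion_subset_thetaHull_settingDHVolSharp_of_movers X hlog M archPk archSub Ψ act Mmod region n lat sig split qData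
        tq t htq0 htq1 0 vQ fun pp x => exists_mover_of_norm_le X hlog tq t pp 0 x ?_
      haveI : Fact (pp : ℕ).Prime := ⟨pp.2⟩
      have h0 : labelIdele X t pp 0 x = 1 := by
        unfold labelIdele
        rw [dif_neg]
        simp
      rw [h0, norm_one]
      exact htqle pp x
    · exact hL i vQ

include ht0 ht htq in
/-- **BRANCH C's PER-DATUM ANTECEDENT FOR REALISING IDELES WITH INTEGRAL q-DEGREES IS THE EXACT TAME PREDICATE** (any columns `col`;
realising q-ideles have norm `≤ 1`, `norm_qIdele_le_one_of_realises`). Same hypotheses as `licence_settingPrVolSharp_iff_of_realises_tame`.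
[cite: DupuyHilado2025, §3.3, §3.4, §4.9] [claim: Mochizuki2012, status: disputed] -/
theorem exists_qPinned_and_hull_settingPrVolSharp_iff_of_realises_tame (e : Nat.Primes → ℕ)
    (hfib : ∀ (pp : Nat.Primes) (x : (thetaIndex X).Fibre (.inr pp)),
      haveI : Fact (pp : ℕ).Prime := ⟨pp.2⟩
      (∃ w : (thetaIndex X).Fibre (.inr pp), placeOf X pp.1 w ∈ X.S) →
        2 < (pp : ℕ) ∧ e pp ≤ (pp : ℕ) - 2 ∧ (placeOf X pp.1 x).asIdeal.ramificationIdx ℤ = e pp)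
    (P : ∀ pp : Nat.Primes, (thetaIndex X).Fibre (.inr pp) → ℕ)
    (hP : ∀ (pp : Nat.Primes) (w : (thetaIndex X).Fibre (.inr pp)),
      haveI : Fact (pp : ℕ).Prime := ⟨pp.2⟩; placeOf X pp.1 w ∈ X.S → X.qPilot (placeOf X pp.1 w) = P pp w)
    (hP1 : ∀ (pp : Nat.Primes) (w : (thetaIndex X).Fibre (.inr pp)),
      haveI : Fact (pp : ℕ).Prime := ⟨pp.2⟩; placeOf X pp.1 w ∈ X.S → 1 ≤ P pp w) :
    (∃ (ρ : (∀ v : (thetaIndex X).V, v ∈ (thetaIndex X).Vbad → Set ((logShellsDH X logv).StarPacket v)) →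
          ∀ (j : (thetaIndex X).Label) (vQ : (thetaIndex X).VQ), Set ((logShellsDH X logv).Packet j vQ))
        (qK : ∀ v : (thetaIndex X).V, v ∈ (thetaIndex X).Vbad → Set ((logShellsDH X logv).StarPacket v)),
        QPinned ({ toSituation := situationPrVol X hlog M archPk archSub Ψ act Mmod region, col := col } :
            LatticeSituation (thetaIndex X))
          (settingPrVolSharp X hlog M archPk archSub Ψ act Mmod region n lat sig split qData tq t htq0 htq1) ρ qK ∧
        PilotKummerCompatHull ({ toSituation := situationPrVol X hlog M archPk archSub Ψ act Mmod region, col := col } :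
            LatticeSituation (thetaIndex X))
          (settingPrVolSharp X hlog M archPk archSub Ψ act Mmod region n lat sig split qData tq t htq0 htq1) ρ qK) ↔
      ∀ (pp : Nat.Primes) (i : Fin (thetaIndex X).lstar) (w : (thetaIndex X).Fibre (.inr pp)),
        haveI : Fact (pp : ℕ).Prime := ⟨pp.2⟩; placeOf X pp.1 w ∈ X.S →
          (e pp : ℤ) * (((((i : ℕ) + 1 : ℕ) : ℤ) ^ 2 * (P pp w : ℤ) - 1) / e pp) + 1 -
            ((i : ℕ) + 1 : ℕ) * ((e pp : ℤ) - 1) ≤ (P pp w : ℤ) := by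
  rw [exists_qPinned_and_hull_settingPrVolSharp_iff_licence X hlog M archPk archSub Ψ act Mmod region n lat sig split qData tq t htq0
    htq1 col (fun pp x => norm_qIdele_le_one_of_realises X tq htq0 htq pp x)]
  exact licence_settingPrVolSharp_iff_of_realises_tame X hlog M archPk archSub Ψ act Mmod region n lat sig split qData tq t htq0 htq1
    ht0 ht htq e hfib P hP hP1

end Summit.ABC.IUTFork.Thm311.Real

end
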